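import Summits.NavierStokesRegularity.FunctionalMining.TopEigLaminateFour
import Summits.NavierStokesRegularity.FunctionalMining.TopEigHeatCoerciveGap
import HarnessLib

/-!
# FunctionalMining — the laminate calibration of L-λ(4) holds INSIDE every top-gap class
# `λ₂ ≤ (1 − η)λ₁`: `TopEigHeatCoerciveOnGap 4 η c → c ≤ (2637/2957)·16π²` for all `η ≤ 1`
# (laminate calibration, part 3)

Search for candidate a priori estimates; no regularity claim. Cell `pub-nsfunc`, prove seat
(gen 19). Bookkeeping between the laminate witness of `TopEigLaminateField` / `TopEigLaminateFour`
and the dictionary's typed Proposition L-λ(η) node (`TopEigHeatCoerciveGap.lean`: `StrainGapClass η v`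
= "`λ₂(x) ≤ (1 − η)·λ₁(x)` everywhere", `TopEigHeatCoerciveOnGap q η c` = Lemma L-λ(q) at rate `c`
restricted to that class). Nothing about Navier–Stokes dynamics is asserted.

* `midEig_u` — the laminate `u = (F(x₂), 0, 0)` has `λ₂(S(u)) ≡ 0` (its strain is the planar
  trace-free plane shear, eigenvalues `±|F′|/2, 0`), hence `strainGapClass_u : StrainGapClass η u` for
  EVERY `η ≤ 1` (the most favourable class `η = 1`, `λ₂ ≤ 0`, included);
* **`topEigHeatCoerciveOnGap_four_rate_le : η ≤ 1 → TopEigHeatCoerciveOnGap 4 η c →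
  c ≤ (2637/2957)·(16π²)`** and `… → c < 16π²`: at `q = 4` no top-gap restriction rescues the
  single-shell rate — the best gap-class constant is already below `4·4π²` on a laminate (which lies
  in every gap class). (At `q = 2` the dictionary's `TopEigGapCoerciveTwo η` asserts a LOWER bound
  `4π²η/(6(1+√3)²)` on the class; the present file is an UPPER calibration at `q = 4` and says nothing
  about positivity.) [ours, calibration]
-/

noncomputable section

open MeasureTheory Set

namespace Summit.NavierStokesRegularity.FunctionalMining

open Literature.Analysis Literature.Analysis.FunctionSpaces Literature.Analysis.FunctionSpaces.Torus
open TopEig PlanarTopEig StrainL4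

namespace TopEigLaminate

/-- **`λ₂(S(u)) ≡ 0`** for the laminate: `λ₂ = tr S − λ₁ − λ₃ = 0 − λ(S) + λ(−S)` and `λ(±S)`
coincide on planar trace-free tensors. [ours] -/
theorem midEig_u (x : UnitAddTorus (Fin 3)) : torusStrainMidEig u x = 0 := by
  obtain ⟨hpl, -, -⟩ := strain_u x
  have htop : torusStrainTopEig u x = lam (strainFlat u x) := (lam_strainFlat u x).symm
  have hbot : torusStrainBotEig u x = -lam (-strainFlat u x) := by
    have h := lam_neg_strainFlat u x
    linarith
  have h1 : lam (strainFlat u x) =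
      Real.sqrt (strainFlat u x (0, 0) ^ 2 + strainFlat u x (0, 2) ^ 2) := hpl.lam_eq
  have h2 : lam (-strainFlat u x) =
      Real.sqrt (strainFlat u x (0, 0) ^ 2 + strainFlat u x (0, 2) ^ 2) := by
    rw [hpl.neg.lam_eq]
    simp only [PiLp.neg_apply, neg_sq]
  unfold torusStrainMidEig
  rw [sum_torusStrainEig_eq_zero isSmooth_u isDivFree_u, htop, hbot, h1, h2]
  ring

/-- **The laminate lies in every top-gap class `λ₂ ≤ (1 − η)λ₁`, `η ≤ 1`.** [ours] -/
theorem strainGapClass_u {η : ℝ} (hη : η ≤ 1) : StrainGapClass η u := fun x => by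
  rw [midEig_u]
  exact mul_nonneg (by linarith) (torusStrainTopEig_nonneg (by simp) isSmooth_u isDivFree_u x)

/-- **`TopEigHeatCoerciveOnGap 4 η c → c ≤ (2637/2957)·(16π²)`** for every `η ≤ 1`: the laminate
calibration of `TopEigLaminateFour` holds inside every top-gap class. [ours, calibration] -/
theorem topEigHeatCoerciveOnGap_four_rate_le {η c : ℝ} (hη : η ≤ 1)
    (h : TopEigHeatCoerciveOnGap (d := Fin 3) 4 η c) : c ≤ 2637 / 2957 * (16 * Real.pi ^ 2) := by
  obtain ⟨hT, -, hpos⟩ := topEigMoment_four_u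
  have hL := h (by simp) u isSmooth_u isDivFree_u hasZeroMean_u (strainGapClass_u hη)
  rw [heatDissipation_topEigMoment_four_u.1, hT] at hL
  exact le_of_mul_le_mul_right hL hpos

/-- Hence `TopEigHeatCoerciveOnGap 4 η c → c < 16π²` (`η ≤ 1`): below the single-shell value on every
gap class. [ours, calibration] -/
theorem topEigHeatCoerciveOnGap_four_rate_lt {η c : ℝ} (hη : η ≤ 1)
    (h : TopEigHeatCoerciveOnGap (d := Fin 3) 4 η c) : c < 16 * Real.pi ^ 2 := by
  have h1 := topEigHeatCoerciveOnGap_four_rate_le hη h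
  have h2 : 2637 / 2957 * (16 * Real.pi ^ 2) < 16 * Real.pi ^ 2 := by
    have : 0 < 16 * Real.pi ^ 2 := by positivity
    nlinarith
  exact lt_of_le_of_lt h1 h2

/-- No gap-class rate above `(2637/2957)·16π²` at `q = 4` (`η ≤ 1`). [ours, calibration] -/
theorem not_topEigHeatCoerciveOnGap_four_of_lt {η c : ℝ} (hη : η ≤ 1)
    (hc : 2637 / 2957 * (16 * Real.pi ^ 2) < c) : ¬ TopEigHeatCoerciveOnGap (d := Fin 3) 4 η c :=
  fun h => absurd (topEigHeatCoerciveOnGap_four_rate_le hη h) (not_le.2 hc)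

end TopEigLaminate

end Summit.NavierStokesRegularity.FunctionalMining

end
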